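import Summits.QuantumFields.YangMills.Theorems.UnitScaleTiltProp7JunctionGroupOfOffsetFamily
import Summits.QuantumFields.YangMills.Theorems.UnitScaleTiltProp7JunctionDeltaCount
import Literature.MathematicalPhysics.QuantumFieldTheory.Balaban1983to89.T3ContinuumYM3Torus
import HarnessLib

/-!
# Route `UnitScaleTilt`, crux K1 «MinimiserStabilityRegPr» (stmt-QuantumFields-19200), route-R E′ path (α′), S3 K-form engine, row (H) — «HJUNC OF THE δ-ROWS» (T³ letters):
# the DISPLAYED junction input `hJunc` of ✓ `Prop7RowsHOfOffsetFamily.rowsH_of_offsetFamilyRows` (and of ★p1's member-level check ✓ `Prop7EngineRowsOfRawRows.engineRows_of_rawRows`),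
# `c_G·(d·JUNC(S)) ≤ C_H·ℓ⁻¹·δV + ζ_G·K + θ_G·e·ℓ⁻²·M`, INHABITED at the straight-comb junction transports `S_(y,z) := T(B(z); Γ_(B(z),y))` (`= axialT T (B z) y`, `T` any
# bi-contractive COARSE gauge field on `T^((K−n))`, e.g. the straight `ℓ`-segment transports of `𝒲`) FROM two displayed commutator rows and two landed theorems:
#   (J-δ) ✓p684320 `Prop7JunctionDeltaCount.sum_junction_delta_le` (px9): `Σ_yΣ_(z∈N(y)) ‖R(S_(y,z))ψ(c_y) − ψ(c_(B z))‖² ≤ 4^d(2d)²ℓ^d·Σ_c ‖(D_T ψ∘c)(c)‖²`,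
#   (Kg″-bridge) ✓p679121 `Prop7LocalModelJunction.norm_R_sub_le_of_defect`, squared: `‖(D_T ψ∘c)(c)‖² ≤ 2‖ψ(c₋) − V̄_c ψ(c₊) V̄_c*‖²_HS + 2‖[V̄_c⁻¹T_c, ψ(c₊)]‖²` with ★p1's averaged
#   field `V̄ = (blockAvg expMeanLogSU)^(K−n) W` — the first summand is ★p1's `δV` letter VERBATIM (op-norm ≤ Hilbert–Schmidt),
#   (Kg″) DISPLAYED `C_H·ℓ⁻¹·Σ_c ‖[V̄_c⁻¹T_c, ψ(c₊)]‖² ≤ ζ₁K + θ₁eℓ⁻²M` and (Kg′-J) DISPLAYED `c_G·d·Σ_yΣ_(z∈N(y)) ℓ′⁻¹Σ_h 2‖[JLOOP^h_(y,z), ψ(c_y)]‖² ≤ ζ₂K + θ₂eℓ⁻²M` (JLOOP VERBATIM ✓p681065).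
# Constants: `c_G = 2·3·(d·(24∕ℓ²)²) = 3456·d·ℓ⁻⁴`; at `d = 3` (`T3Family.P_d`) `c_G·d·2·(4^d(2d)²ℓ^d)·2 = 286654464·ℓ⁻¹` EXACTLY, so `C_H := 286654464` (ℓ-free), `ζ_G := ζ₁ + ζ₂`,
# `θ_G := θ₁ + θ₂`; `K`, `M`, `e` are free reals here (★p1's member letters at the consumer).

Cell `ym3-torus`, D-0154 (3c) twin-width seat `ym-routeR-w1` (gen 7); row named for routeR-w1 g7 by routeR-w1 g6's FINAL § («F-H9q-Σ consumer») and px9 g4 (✓p684320's «HOW THE KNIT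
READS IT»).  THEOREMS ONLY (0 `def`, 0 `sorry`); `--supports stmt-QuantumFields-19200`, count-neutral.  YM₃ on T³ is a ladder rung (R3) — not d = 4, not infinite volume, not a
mass gap, not the Clay problem; nothing here claims (H), S3, E′, a stub, the crux or any summit statement — rows (Kg″) and (Kg′-J) are DISPLAYED.

WHAT IS PROVED (ns `…Theorems.Prop7HJuncOfDeltaRows`).
* §1 (normed ring ∕ `M₂(ℂ)`): `norm_R_sub_sq_le_of_defect` (the (Kg″) bridge squared), `norm_sq_le_sum_normSq` (`‖X‖²_op ≤ Σ_ab |X_ab|²`), `R_unitsField_toUField` (`R(V̄_c)m = V̄_c m V̄_c*`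
  for an `SU(2)` field read in units), ★ `covD_sq_le_bridge` ∕ `sum_covD_sq_le_bridge` (per coarse bond and summed: `‖(D_T f)(c)‖² ≤ 2‖f(c₋) − V̄_c f(c₊)V̄_c*‖²_HS + 2‖[V̄_c⁻¹T_c, f(c₊)]‖²`).
* §2 (any torus): `rel_mem_window` (the window letter `rel (B z) y ∈ {−1,0,1,2}^d` read off the support predicate — unconditional, also on tiny tori), `sum_sum_ite_avg_split`
  (`Σ[N] ℓ′⁻¹Σ_h 2(δ + J_h) = 2Σ[N]δ + Σ[N]ℓ′⁻¹Σ_h 2J_h`).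
* §3 ★★★ `hJunc_of_deltaRows` (T³ letters): hJunc of ✓p682294 VERBATIM at `S y z := holT T (B z) (treeWord (rel (B z) y))` ⟸ (Kg″) ∧ (Kg′-J), constants `(286654464, ζ₁+ζ₂, θ₁+θ₂)`;
  ★★ `hJunc_of_deltaRows_straight`: the same with `T c := 𝒲(c_(c₋); [c.dir]^ℓ)` (the straight `ℓ`-segment transports; bi-contractivity discharged by ✓ `bicontr_holT`).
HONEST SCOPE.  A bookkeeping knit of landed theorems: no estimate of Bałaban's is asserted; the two commutator rows are DISPLAYED (their booking against `K_gauge` ∕ `M` is the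
criticality content, not here); the constant is pure arithmetic at `d = 3`.

References: T. Bałaban, CMP 99 (1985) 389–434 [Balaban1985BackgroundPropagators] ((3.1) p.390, (3.3)–(3.4) pp.390–391, (3.8) p.392, (3.12) p.392); CMP 98 (1985) 17–51
[Balaban1985Averaging] ((9) p.18, (19)–(20) p.21); CMP 95 (1984) 17–40 [Balaban1984PropagatorsI] ((1.18) p.20); CMP 102 (1985) 255–275 [Balaban1985UV3] ((27) p.263).
-/

set_option autoImplicit false

noncomputable section

open scoped BigOperators Matrix.Norms.L2Operator Matrix

namespace Summit.QuantumFields.YangMills.Theorems.Prop7HJuncOfDeltaRows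

open Literature.MathematicalPhysics.QuantumFieldTheory.Balaban1983to89
open Literature.MathematicalPhysics.QuantumFieldTheory.Balaban1983to89.T3ContinuumYM3Torus
open BlockAveraging (blockAvg)
open ExpMeanLog (expMeanLogSU)
open B7Prop1Explicit (Letter e seg treeWord)
open B9Eq39Adjoint (R R_def covD)
open B9TorusCalculus (torusT torusT_apply)
open B10Eq27TorusAxialLog (unitsField toUField holT axialT rel transl transl_rel rel_apply rel_mem_Ioc)
open B5Eq118OneStroke (iterBlockOf)
open B15DeterminingSets (embIter)
open Summit.QuantumFields.YangMills.Theorems.Prop7CovHodgeSplit (unitsField_toUField_mem_unitary)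
open Summit.QuantumFields.YangMills.Theorems.Prop7LemmaHCurvedOfRows (bicontr_of_mem_unitary)
open Summit.QuantumFields.YangMills.Theorems.Prop7AxialLocalModel (bicontr_holT)
open Summit.QuantumFields.YangMills.Theorems.Prop7LocalModelJunction (norm_R_sub_le_of_defect)
open Summit.QuantumFields.YangMills.Theorems.Prop7JunctionDeltaCount (sum_junction_delta_le)

/-! ## §1 The (Kg″) bridge squared, operator norm versus Hilbert–Schmidt, the averaged link as a unit -/

section Algebra

variable {𝔸 : Type*} [NormedRing 𝔸]

/-- the `W̄ ↔ S` defect bridge ✓ `norm_R_sub_le_of_defect`, SQUARED: `‖R(S)m − m′‖² ≤ 2‖R(T)m − m′‖² + 2‖(T⁻¹S)m − m(T⁻¹S)‖²` for bi-contractive `S, T`.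
[cite: Balaban1985BackgroundPropagators, (3.1) p.390, (3.12) p.392] -/
theorem norm_R_sub_sq_le_of_defect {S T : 𝔸ˣ} (hS : ‖(S : 𝔸)‖ ≤ 1 ∧ ‖((S⁻¹ : 𝔸ˣ) : 𝔸)‖ ≤ 1) (hT : ‖(T : 𝔸)‖ ≤ 1 ∧ ‖((T⁻¹ : 𝔸ˣ) : 𝔸)‖ ≤ 1) (m m' : 𝔸) :
    ‖R S m - m'‖ ^ 2 ≤ 2 * ‖R T m - m'‖ ^ 2 + 2 * ‖((T⁻¹ * S : 𝔸ˣ) : 𝔸) * m - m * ((T⁻¹ * S : 𝔸ˣ) : 𝔸)‖ ^ 2 := by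
  have h := norm_R_sub_le_of_defect hS hT m m'
  have h2 : ∀ a b x : ℝ, 0 ≤ x → x ≤ a + b → x ^ 2 ≤ 2 * a ^ 2 + 2 * b ^ 2 := fun a b x hx hab => by nlinarith [sq_nonneg (a - b)]
  exact h2 _ _ _ (norm_nonneg _) h

end Algebra

section Matrix2

/-- `‖X‖²_op ≤ Σ_ab |X_ab|²` on `M₂(ℂ)` (✓ `MatrixNorms.opNorm_sq_le_sum_norm_sq`, `|z|² = normSq z`) — the seam from the operator-norm junction to ★p1's Hilbert–Schmidt `δV` letter.
[cite: Balaban1985Averaging, (19)-(20) p.21] -/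
theorem norm_sq_le_sum_normSq (X : Matrix (Fin 2) (Fin 2) ℂ) : ‖X‖ ^ 2 ≤ ∑ a : Fin 2, ∑ b : Fin 2, Complex.normSq (X a b) := by
  have h := MatrixNorms.opNorm_sq_le_sum_norm_sq X
  simpa only [Complex.normSq_eq_norm_sq] using h

/-- an `SU(2)` bond field read in units acts by `R(V̄_c)m = V̄_c·m·V̄_c*`. [cite: Balaban1985Averaging, (19) p.21] -/
theorem R_unitsField_toUField {P : Params} {j : ℕ} (U : GaugeField P j (Matrix.specialUnitaryGroup (Fin 2) ℂ)) (c : PBond P j) (m : Matrix (Fin 2) (Fin 2) ℂ) :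
    R (unitsField (toUField U) c) m = ((U c : Matrix.specialUnitaryGroup (Fin 2) ℂ) : Matrix (Fin 2) (Fin 2) ℂ) * m * star ((U c : Matrix.specialUnitaryGroup (Fin 2) ℂ) : Matrix (Fin 2) (Fin 2) ℂ) := by
  have hu : ((unitsField (toUField U) c : (Matrix (Fin 2) (Fin 2) ℂ)ˣ) : Matrix (Fin 2) (Fin 2) ℂ) ∈ unitary (Matrix (Fin 2) (Fin 2) ℂ) :=
    unitsField_toUField_mem_unitary U c.dir c.src
  have hval : ((unitsField (toUField U) c : (Matrix (Fin 2) (Fin 2) ℂ)ˣ) : Matrix (Fin 2) (Fin 2) ℂ) = ((U c : Matrix.specialUnitaryGroup (Fin 2) ℂ) : Matrix (Fin 2) (Fin 2) ℂ) := rfl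
  have hinv : (((unitsField (toUField U) c)⁻¹ : (Matrix (Fin 2) (Fin 2) ℂ)ˣ) : Matrix (Fin 2) (Fin 2) ℂ) = star ((U c : Matrix.specialUnitaryGroup (Fin 2) ℂ) : Matrix (Fin 2) (Fin 2) ℂ) := by
    rw [← hval]; exact Units.inv_eq_of_mul_eq_one_left (Unitary.star_mul_self_of_mem hu)
  rw [R_def, hinv, hval]

variable {P : Params} {j : ℕ}

/-- ★ **THE (Kg″) BRIDGE PER COARSE BOND**: for an `SU(2)` field `U` (★p1's averaged `V̄`), a bi-contractive field `T` (the consumer's straight transports) and any site field `f`,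
`‖(D_T f)(c)‖² ≤ 2·Σ_ab |(f(c₋) − U_c f(c₊) U_c*)_ab|² + 2·‖(U_c⁻¹T_c)f(c₊) − f(c₊)(U_c⁻¹T_c)‖²` (✓ `norm_R_sub_sq_le_of_defect` ∘ op ≤ HS).
[cite: Balaban1985BackgroundPropagators, (3.3) p.390, (3.1) p.390, (3.12) p.392] [cite: Balaban1985Averaging, (19)-(20) p.21] -/
theorem covD_sq_le_bridge (U : GaugeField P j (Matrix.specialUnitaryGroup (Fin 2) ℂ)) (T : GaugeField P j (Matrix (Fin 2) (Fin 2) ℂ)ˣ)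
    (hT : ∀ c : PBond P j, ‖(T c : Matrix (Fin 2) (Fin 2) ℂ)‖ ≤ 1 ∧ ‖(((T c)⁻¹ : (Matrix (Fin 2) (Fin 2) ℂ)ˣ) : Matrix (Fin 2) (Fin 2) ℂ)‖ ≤ 1)
    (f : Site P j → Matrix (Fin 2) (Fin 2) ℂ) (c : PBond P j) :
    ‖covD (torusT P j) (fun κ z => T ⟨z, κ⟩) c.dir f c.src‖ ^ 2
      ≤ 2 * ∑ a : Fin 2, ∑ b : Fin 2, Complex.normSq ((f c.src - ((U c : Matrix.specialUnitaryGroup (Fin 2) ℂ) : Matrix (Fin 2) (Fin 2) ℂ) * f c.tgt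
            * star ((U c : Matrix.specialUnitaryGroup (Fin 2) ℂ) : Matrix (Fin 2) (Fin 2) ℂ)) a b)
        + 2 * ‖(((unitsField (toUField U) c)⁻¹ * T c : (Matrix (Fin 2) (Fin 2) ℂ)ˣ) : Matrix (Fin 2) (Fin 2) ℂ) * f c.tgt
            - f c.tgt * (((unitsField (toUField U) c)⁻¹ * T c : (Matrix (Fin 2) (Fin 2) ℂ)ˣ) : Matrix (Fin 2) (Fin 2) ℂ)‖ ^ 2 := by
  have hU : ‖((unitsField (toUField U) c : (Matrix (Fin 2) (Fin 2) ℂ)ˣ) : Matrix (Fin 2) (Fin 2) ℂ)‖ ≤ 1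
      ∧ ‖(((unitsField (toUField U) c)⁻¹ : (Matrix (Fin 2) (Fin 2) ℂ)ˣ) : Matrix (Fin 2) (Fin 2) ℂ)‖ ≤ 1 :=
    bicontr_of_mem_unitary _ (unitsField_toUField_mem_unitary U c.dir c.src)
  have e1 : covD (torusT P j) (fun κ z => T ⟨z, κ⟩) c.dir f c.src = R (T c) (f c.tgt) - f c.src := rfl
  rw [e1]
  refine (norm_R_sub_sq_le_of_defect (hT c) hU (f c.tgt) (f c.src)).trans (add_le_add (mul_le_mul_of_nonneg_left ?_ zero_le_two) le_rfl)
  rw [norm_sub_rev, R_unitsField_toUField]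
  exact norm_sq_le_sum_normSq _

/-- … SUMMED over the coarse bonds: `Σ_c ‖(D_T f)(c)‖² ≤ 2·(Σ_c Σ_ab |(f(c₋) − U_c f(c₊)U_c*)_ab|² + Σ_c ‖[U_c⁻¹T_c, f(c₊)]‖²)`.
[cite: Balaban1985BackgroundPropagators, (3.3) p.390, (3.12) p.392] [cite: Balaban1985Averaging, (19)-(20) p.21] -/
theorem sum_covD_sq_le_bridge (U : GaugeField P j (Matrix.specialUnitaryGroup (Fin 2) ℂ)) (T : GaugeField P j (Matrix (Fin 2) (Fin 2) ℂ)ˣ)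
    (hT : ∀ c : PBond P j, ‖(T c : Matrix (Fin 2) (Fin 2) ℂ)‖ ≤ 1 ∧ ‖(((T c)⁻¹ : (Matrix (Fin 2) (Fin 2) ℂ)ˣ) : Matrix (Fin 2) (Fin 2) ℂ)‖ ≤ 1)
    (f : Site P j → Matrix (Fin 2) (Fin 2) ℂ) :
    ∑ c : PBond P j, ‖covD (torusT P j) (fun κ z => T ⟨z, κ⟩) c.dir f c.src‖ ^ 2
      ≤ 2 * ((∑ c : PBond P j, ∑ a : Fin 2, ∑ b : Fin 2, Complex.normSq ((f c.src - ((U c : Matrix.specialUnitaryGroup (Fin 2) ℂ) : Matrix (Fin 2) (Fin 2) ℂ) * f c.tgt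
            * star ((U c : Matrix.specialUnitaryGroup (Fin 2) ℂ) : Matrix (Fin 2) (Fin 2) ℂ)) a b))
        + ∑ c : PBond P j, ‖(((unitsField (toUField U) c)⁻¹ * T c : (Matrix (Fin 2) (Fin 2) ℂ)ˣ) : Matrix (Fin 2) (Fin 2) ℂ) * f c.tgt
            - f c.tgt * (((unitsField (toUField U) c)⁻¹ * T c : (Matrix (Fin 2) (Fin 2) ℂ)ˣ) : Matrix (Fin 2) (Fin 2) ℂ)‖ ^ 2) := by
  rw [mul_add, Finset.mul_sum, Finset.mul_sum, ← Finset.sum_add_distrib]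
  exact Finset.sum_le_sum fun c _ => covD_sq_le_bridge U T hT f c

end Matrix2

/-! ## §2 The window letter read off the support, and the split of the averaged junction summand -/

section Window

variable {P : Params} {k : ℕ}

/-- THE WINDOW LETTER READ OFF THE SUPPORT: if every coordinate of `y` is one of `B_ν − 1, B_ν, B_ν + 1, B_ν + 2`, then `rel B y ∈ {−1,0,1,2}^d` — UNCONDITIONALLY in the period
(on a torus with `≤ 4` sites per direction the symmetric representative lies in `(−2, 2]` anyway). [cite: Balaban1985UV3, (27) p.263] -/
theorem rel_mem_window (B y : Site P k) (h : ∀ ν : Fin P.d, (y ν = B ν - 1 ∨ y ν = B ν ∨ y ν = B ν + 1 ∨ y ν = B ν + 2)) :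
    rel B y ∈ Fintype.piFinset (fun _ : Fin P.d => ({-1, 0, 1, 2} : Finset ℤ)) := by
  rw [Fintype.mem_piFinset]
  intro ν
  have hr := rel_mem_Ioc B y ν
  rw [Set.mem_Ioc] at hr
  simp only [Finset.mem_insert, Finset.mem_singleton]
  by_cases hN : 5 ≤ P.sitesPerDir k
  · have key : ∀ q : ℤ, (q = -1 ∨ q = 0 ∨ q = 1 ∨ q = 2) → y ν - B ν = ((q : ℤ) : ZMod (P.sitesPerDir k)) → rel B y ν = q := by
      intro q hq hyq
      rw [rel_apply]
      refine (ZMod.valMinAbs_spec _ _).2 ⟨hyq, ?_⟩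
      rw [Set.mem_Ioc]
      have h5 : (5 : ℤ) ≤ (P.sitesPerDir k : ℤ) := by exact_mod_cast hN
      rcases hq with hq | hq | hq | hq <;> subst hq <;> constructor <;> linarith
    rcases h ν with h1 | h1 | h1 | h1
    · exact Or.inl (key (-1) (Or.inl rfl) (by rw [h1]; push_cast; ring))
    · exact Or.inr (Or.inl (key 0 (Or.inr (Or.inl rfl)) (by rw [h1]; push_cast; ring)))
    · exact Or.inr (Or.inr (Or.inl (key 1 (Or.inr (Or.inr (Or.inl rfl))) (by rw [h1]; push_cast; ring))))
    · exact Or.inr (Or.inr (Or.inr (key 2 (Or.inr (Or.inr (Or.inr rfl))) (by rw [h1]; push_cast; ring))))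
  · have h4 : (P.sitesPerDir k : ℤ) < 5 := by exact_mod_cast Nat.lt_of_not_le hN
    omega

end Window

section Split

/-- THE SPLIT OF THE AVERAGED JUNCTION SUMMAND: `Σ_yΣ_z [N] ℓ′⁻¹Σ_(h<ℓ′) 2(δ_(y,z) + J_(y,z,h)) = 2·Σ_yΣ_z [N] δ_(y,z) + Σ_yΣ_z [N] ℓ′⁻¹Σ_h 2J_(y,z,h)` (the δ-part does not depend on the
offset `h`). [folklore] -/
theorem sum_sum_ite_avg_split {α β : Type*} [Fintype α] [Fintype β] (N : α → β → Prop) [∀ y z, Decidable (N y z)] (ℓ' : ℕ) [NeZero ℓ']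
    (δ : α → β → ℝ) (J : α → β → Fin ℓ' → ℝ) :
    ∑ y, ∑ z, (if N y z then (ℓ' : ℝ)⁻¹ * ∑ η : Fin ℓ', 2 * (δ y z + J y z η) else 0)
      = 2 * ∑ y, ∑ z, (if N y z then δ y z else 0) + ∑ y, ∑ z, (if N y z then (ℓ' : ℝ)⁻¹ * ∑ η : Fin ℓ', 2 * J y z η else 0) := by
  have hc : (ℓ' : ℝ) ≠ 0 := by exact_mod_cast (NeZero.ne ℓ')
  rw [Finset.mul_sum, ← Finset.sum_add_distrib]
  refine Finset.sum_congr rfl fun y _ => ?_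
  rw [Finset.mul_sum, ← Finset.sum_add_distrib]
  refine Finset.sum_congr rfl fun z _ => ?_
  split_ifs with hyz
  · have e1 : ∑ η : Fin ℓ', 2 * (δ y z + J y z η) = (ℓ' : ℝ) * (2 * δ y z) + ∑ η : Fin ℓ', 2 * J y z η := by
      simp only [mul_add, Finset.sum_add_distrib, Finset.sum_const, Finset.card_univ, Fintype.card_fin, nsmul_eq_mul]
    rw [e1, mul_add, ← mul_assoc, inv_mul_cancel₀ hc, one_mul]
  · simp

end Split

/-! ## §3 hJunc of the δ-rows on T³ -/

section T3

/-- ★★★ **hJunc OF THE δ-ROWS** — ✓ `rowsH_of_offsetFamilyRows`'s displayed input `hJunc` INHABITED at the straight-comb junction transports `S_(y,z) := holT T (B z) (treeWord (rel (B z) y))`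
(`B z = iterBlockOf (K−n) (z − s𝟙)` the support's reference block, `T` any bi-contractive coarse field): from the DISPLAYED commutator rows (Kg″) (averaging defects `V̄_c⁻¹T_c` against `ψ(c₊)`)
and (Kg′-J) (junction loops), via ✓ `sum_junction_delta_le` + ✓ `sum_covD_sq_le_bridge`; output constants `C_H := 286654464` (`= c_G·d·4·4^d(2d)²ℓ^d·ℓ` at `d = 3`, ℓ-free),
`ζ_G := ζ₁ + ζ₂`, `θ_G := θ₁ + θ₂`; `δV` is ★p1's letter `Σ_c Σ_ab |(ψ(c₋) − V̄_c ψ(c₊) V̄_c*)_ab|²`, `V̄ = (blockAvg expMeanLogSU)^(K−n) W`.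
[cite: Balaban1985BackgroundPropagators, (3.1) p.390, (3.3) p.390, (3.8) p.392, (3.12) p.392] [cite: Balaban1985Averaging, (9) p.18, (19)-(20) p.21]
[cite: Balaban1984PropagatorsI, (1.18) p.20] [cite: Balaban1985UV3, (27) p.263] -/
theorem hJunc_of_deltaRows (F : T3Family) (K n : ℕ) (hk : K - n ≤ (F.P K).m + (F.P K).K)
    (W : GaugeField (F.P K) 0 (Matrix.specialUnitaryGroup (Fin 2) ℂ)) (ψ : Site (F.P K) 0 → Matrix (Fin 2) (Fin 2) ℂ)
    (ι : Fin (F.P K).d) (ℓ' : ℕ) [NeZero ℓ']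
    (T : GaugeField (F.P K) (K - n) (Matrix (Fin 2) (Fin 2) ℂ)ˣ)
    (hT : ∀ c : PBond (F.P K) (K - n), ‖(T c : Matrix (Fin 2) (Fin 2) ℂ)‖ ≤ 1 ∧ ‖(((T c)⁻¹ : (Matrix (Fin 2) (Fin 2) ℂ)ˣ) : Matrix (Fin 2) (Fin 2) ℂ)‖ ≤ 1)
    {Kr Mr ee ζ₁ θ₁ ζ₂ θ₂ : ℝ}
    -- ▢ (Kg″) DISPLAYED: the averaging-defect commutators of the coarse transports against ★p1's averaged field `V̄ = (blockAvg expMeanLogSU)^(K−n) W`, in K ∕ M currency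
    (hKg2 : 286654464 * ((F.L : ℝ) ^ (K - n))⁻¹ * (∑ c : PBond (F.P K) (K - n), ‖(((unitsField (toUField (Averaging.iter (fun i => blockAvg (P := F.P K) (j := i) (expMeanLogSU (n := Fin 2))) (K - n) W)) c)⁻¹ * T c : (Matrix (Fin 2) (Fin 2) ℂ)ˣ) : Matrix (Fin 2) (Fin 2) ℂ) * ψ (embIter (K - n) c.tgt) - ψ (embIter (K - n) c.tgt) * (((unitsField (toUField (Averaging.iter (fun i => blockAvg (P := F.P K) (j := i) (expMeanLogSU (n := Fin 2))) (K - n) W)) c)⁻¹ * T c : (Matrix (Fin 2) (Fin 2) ℂ)ˣ) : Matrix (Fin 2) (Fin 2) ℂ)‖ ^ 2)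
        ≤ ζ₁ * Kr + θ₁ * ee * (((F.L : ℝ) ^ (K - n)) ^ 2)⁻¹ * Mr)
    -- ▢ (Kg′-J) DISPLAYED: the junction-loop commutator family of ✓ `junctionGroup_offsetFamily_le` at these `S`, in K ∕ M currency
    (hKgJ : 2 * (3 * (((F.P K).d : ℝ) * (24 / ((((F.P K).L ^ (K - n) : ℕ) : ℝ)) ^ 2) ^ 2))
          * (((F.P K).d : ℝ) * ∑ y : Site (F.P K) (K - n), ∑ z : Site (F.P K) 0,
      (if (∀ ν : Fin (F.P K).d,
          (y ν = (iterBlockOf (K - n) (fun κ => z κ - (((((F.P K).L ^ (K - n) - 1) / 2 : ℕ)) : ZMod ((F.P K).sitesPerDir 0)))) ν - 1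
          ∨ y ν = (iterBlockOf (K - n) (fun κ => z κ - (((((F.P K).L ^ (K - n) - 1) / 2 : ℕ)) : ZMod ((F.P K).sitesPerDir 0)))) ν
          ∨ y ν = (iterBlockOf (K - n) (fun κ => z κ - (((((F.P K).L ^ (K - n) - 1) / 2 : ℕ)) : ZMod ((F.P K).sitesPerDir 0)))) ν + 1
          ∨ y ν = (iterBlockOf (K - n) (fun κ => z κ - (((((F.P K).L ^ (K - n) - 1) / 2 : ℕ)) : ZMod ((F.P K).sitesPerDir 0)))) ν + 2))
        then (ℓ' : ℝ)⁻¹ * ∑ η : Fin ℓ', 2 * ‖(((holT T (iterBlockOf (K - n) (fun κ => z κ - (((((F.P K).L ^ (K - n) - 1) / 2 : ℕ)) : ZMod ((F.P K).sitesPerDir 0)))) (treeWord (rel (iterBlockOf (K - n) (fun κ => z κ - (((((F.P K).L ^ (K - n) - 1) / 2 : ℕ)) : ZMod ((F.P K).sitesPerDir 0)))) y)))⁻¹ * holT (unitsField (toUField W)) (embIter (K - n) (iterBlockOf (K - n) (fun κ => z κ - (((((F.P K).L ^ (K - n) - 1) / 2 : ℕ)) : ZMod ((F.P K).sitesPerDir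 0))))) (seg ι ((η : ℕ) : ℤ) ++ treeWord (rel (transl (embIter (K - n) (iterBlockOf (K - n) (fun κ => z κ - (((((F.P K).L ^ (K - n) - 1) / 2 : ℕ)) : ZMod ((F.P K).sitesPerDir 0))))) (((η : ℕ) : ℤ) • e ι)) z)) * (holT (unitsField (toUField W)) (embIter (K - n) y) (seg ι ((η : ℕ) : ℤ) ++ treeWord (rel (transl (embIter (K - n) y) (((η : ℕ) : ℤ) • e ι)) z)))⁻¹ : (Matrix (Fin 2) (Fin 2) ℂ)ˣ) : Matrix (Fin 2) (Fin 2) ℂ) * ψ (embIter (K - n) y)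
                - ψ (embIter (K - n) y) * (((holT T (iterBlockOf (K - n) (fun κ => z κ - (((((F.P K).L ^ (K - n) - 1) / 2 : ℕ)) : ZMod ((F.P K).sitesPerDir 0)))) (treeWord (rel (iterBlockOf (K - n) (fun κ => z κ - (((((F.P K).L ^ (K - n) - 1) / 2 : ℕ)) : ZMod ((F.P K).sitesPerDir 0)))) y)))⁻¹ * holT (unitsField (toUField W)) (embIter (K - n) (iterBlockOf (K - n) (fun κ => z κ - (((((F.P K).L ^ (K - n) - 1) / 2 : ℕ)) : ZMod ((F.P K).sitesPerDir 0))))) (seg ι ((η : ℕ) : ℤ) ++ treeWord (rel (transl (embIter (K - n) (iterBlockOf (K - n) (fun κ => z κ - (((((F.P K).L ^ (K - n) - 1) / 2 : ℕ)) : ZMod ((F.P K).sitesPerDir 0))))) (((η : ℕ) : ℤ) • e ι)) z)) * (holT (unitsField (toUField W)) (embIter (K - n) y) (seg ι ((η : ℕ) : ℤ) ++ treeWord (rel (transl (embIter (K - n) y) (((η : ℕ) : ℤ) • e ι)) z)))⁻¹ : (Matrix (Fin 2) (Fin 2) ℂ)ˣ) : Matrix (Fin 2) (Fin 2) ℂ)‖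 ^ 2 else 0))
        ≤ ζ₂ * Kr + θ₂ * ee * (((F.L : ℝ) ^ (K - n)) ^ 2)⁻¹ * Mr) :
    2 * (3 * (((F.P K).d : ℝ) * (24 / ((((F.P K).L ^ (K - n) : ℕ) : ℝ)) ^ 2) ^ 2))
          * (((F.P K).d : ℝ) * ∑ y : Site (F.P K) (K - n), ∑ z : Site (F.P K) 0,
      (if (∀ ν : Fin (F.P K).d,
          (y ν = (iterBlockOf (K - n) (fun κ => z κ - (((((F.P K).L ^ (K - n) - 1) / 2 : ℕ)) : ZMod ((F.P K).sitesPerDir 0)))) ν - 1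
          ∨ y ν = (iterBlockOf (K - n) (fun κ => z κ - (((((F.P K).L ^ (K - n) - 1) / 2 : ℕ)) : ZMod ((F.P K).sitesPerDir 0)))) ν
          ∨ y ν = (iterBlockOf (K - n) (fun κ => z κ - (((((F.P K).L ^ (K - n) - 1) / 2 : ℕ)) : ZMod ((F.P K).sitesPerDir 0)))) ν + 1
          ∨ y ν = (iterBlockOf (K - n) (fun κ => z κ - (((((F.P K).L ^ (K - n) - 1) / 2 : ℕ)) : ZMod ((F.P K).sitesPerDir 0)))) ν + 2))
        then (ℓ' : ℝ)⁻¹ * ∑ η : Fin ℓ', 2 * (‖R (holT T (iterBlockOf (K - n) (fun κ => z κ - (((((F.P K).L ^ (K - n) - 1) / 2 : ℕ)) : ZMod ((F.P K).sitesPerDir 0)))) (treeWord (rel (iterBlockOf (K - n) (fun κ => z κ - (((((F.P K).L ^ (K - n) - 1) / 2 : ℕ)) : ZMod ((F.P K).sitesPerDir 0)))) y))) (ψ (embIter (K - n) y)) - ψ (embIter (K - n) (iterBlockOf (K - n) (fun κ => z κ - (((((F.P K).L ^ (K - n) - 1) / 2 : ℕ)) : ZMod ((F.P K).sitesPerDir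 0)))))‖ ^ 2
            + ‖(((holT T (iterBlockOf (K - n) (fun κ => z κ - (((((F.P K).L ^ (K - n) - 1) / 2 : ℕ)) : ZMod ((F.P K).sitesPerDir 0)))) (treeWord (rel (iterBlockOf (K - n) (fun κ => z κ - (((((F.P K).L ^ (K - n) - 1) / 2 : ℕ)) : ZMod ((F.P K).sitesPerDir 0)))) y)))⁻¹ * holT (unitsField (toUField W)) (embIter (K - n) (iterBlockOf (K - n) (fun κ => z κ - (((((F.P K).L ^ (K - n) - 1) / 2 : ℕ)) : ZMod ((F.P K).sitesPerDir 0))))) (seg ι ((η : ℕ) : ℤ) ++ treeWord (rel (transl (embIter (K - n) (iterBlockOf (K - n) (fun κ => z κ - (((((F.P K).L ^ (K - n) - 1) / 2 : ℕ)) : ZMod ((F.P K).sitesPerDir 0))))) (((η : ℕ) : ℤ) • e ι)) z)) * (holT (unitsField (toUField W)) (embIter (K - n) y) (seg ι ((η : ℕ) : ℤ) ++ treeWord (rel (transl (embIter (K - n) y) (((η : ℕ) : ℤ) • e ι)) z)))⁻¹ : (Matrix (Fin 2) (Fin 2) ℂ)ˣ) : Matrix (Fin 2) (Fin 2) ℂ)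 * ψ (embIter (K - n) y)
                - ψ (embIter (K - n) y) * (((holT T (iterBlockOf (K - n) (fun κ => z κ - (((((F.P K).L ^ (K - n) - 1) / 2 : ℕ)) : ZMod ((F.P K).sitesPerDir 0)))) (treeWord (rel (iterBlockOf (K - n) (fun κ => z κ - (((((F.P K).L ^ (K - n) - 1) / 2 : ℕ)) : ZMod ((F.P K).sitesPerDir 0)))) y)))⁻¹ * holT (unitsField (toUField W)) (embIter (K - n) (iterBlockOf (K - n) (fun κ => z κ - (((((F.P K).L ^ (K - n) - 1) / 2 : ℕ)) : ZMod ((F.P K).sitesPerDir 0))))) (seg ι ((η : ℕ) : ℤ) ++ treeWord (rel (transl (embIter (K - n) (iterBlockOf (K - n) (fun κ => z κ - (((((F.P K).L ^ (K - n) - 1) / 2 : ℕ)) : ZMod ((F.P K).sitesPerDir 0))))) (((η : ℕ) : ℤ) • e ι)) z)) * (holT (unitsField (toUField W)) (embIter (K - n) y) (seg ι ((η : ℕ) : ℤ) ++ treeWord (rel (transl (embIter (K - n) y) (((η : ℕ) : ℤ) • e ι)) z)))⁻¹ : (Matrix (Fin 2) (Fin 2) ℂ)ˣ) : Matrix (Fin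 2) (Fin 2) ℂ)‖ ^ 2) else 0))
        ≤ 286654464 * ((F.L : ℝ) ^ (K - n))⁻¹ * (∑ c : PBond (F.P K) (K - n), ∑ a : Fin 2, ∑ b : Fin 2,
                Complex.normSq ((ψ (embIter (K - n) c.src) - (((Averaging.iter (fun i => blockAvg (P := F.P K) (j := i) (expMeanLogSU (n := Fin 2))) (K - n) W) c : Matrix.specialUnitaryGroup (Fin 2) ℂ) : Matrix (Fin 2) (Fin 2) ℂ)
                    * ψ (embIter (K - n) c.tgt) * star (((Averaging.iter (fun i => blockAvg (P := F.P K) (j := i) (expMeanLogSU (n := Fin 2))) (K - n) W) c : Matrix.specialUnitaryGroup (Fin 2) ℂ) : Matrix (Fin 2) (Fin 2) ℂ)) a b)) + (ζ₁ + ζ₂) * Kr + (θ₁ + θ₂) * ee * (((F.L : ℝ) ^ (K - n)) ^ 2)⁻¹ * Mr := by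
  -- the window letter `v y z := rel (B z) y` of ✓ `sum_junction_delta_le`
  have hv : ∀ (y : Site (F.P K) (K - n)) (z : Site (F.P K) 0),
      (∀ ν : Fin (F.P K).d,
          (y ν = (iterBlockOf (K - n) (fun κ => z κ - (((((F.P K).L ^ (K - n) - 1) / 2 : ℕ)) : ZMod ((F.P K).sitesPerDir 0)))) ν - 1
          ∨ y ν = (iterBlockOf (K - n) (fun κ => z κ - (((((F.P K).L ^ (K - n) - 1) / 2 : ℕ)) : ZMod ((F.P K).sitesPerDir 0)))) ν
          ∨ y ν = (iterBlockOf (K - n) (fun κ => z κ - (((((F.P K).L ^ (K - n) - 1) / 2 : ℕ)) : ZMod ((F.P K).sitesPerDir 0)))) ν + 1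
          ∨ y ν = (iterBlockOf (K - n) (fun κ => z κ - (((((F.P K).L ^ (K - n) - 1) / 2 : ℕ)) : ZMod ((F.P K).sitesPerDir 0)))) ν + 2)) →
      rel (iterBlockOf (K - n) (fun κ => z κ - (((((F.P K).L ^ (K - n) - 1) / 2 : ℕ)) : ZMod ((F.P K).sitesPerDir 0)))) y ∈ Fintype.piFinset (fun _ : Fin (F.P K).d => ({-1, 0, 1, 2} : Finset ℤ))
        ∧ transl (iterBlockOf (K - n) (fun κ => z κ - (((((F.P K).L ^ (K - n) - 1) / 2 : ℕ)) : ZMod ((F.P K).sitesPerDir 0)))) (rel (iterBlockOf (K - n) (fun κ => z κ - (((((F.P K).L ^ (K - n) - 1) / 2 : ℕ)) : ZMod ((F.P K).sitesPerDir 0)))) y) = y :=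
    fun y z hyz => ⟨rel_mem_window _ _ hyz, transl_rel _ _⟩
  -- (J-δ): px9's coarse count at `f := ψ ∘ embIter (K−n)`, `v y z := rel (B z) y`
  have h3 : ∑ y : Site (F.P K) (K - n), ∑ z : Site (F.P K) 0,
      (if (∀ ν : Fin (F.P K).d,
          (y ν = (iterBlockOf (K - n) (fun κ => z κ - (((((F.P K).L ^ (K - n) - 1) / 2 : ℕ)) : ZMod ((F.P K).sitesPerDir 0)))) ν - 1
          ∨ y ν = (iterBlockOf (K - n) (fun κ => z κ - (((((F.P K).L ^ (K - n) - 1) / 2 : ℕ)) : ZMod ((F.P K).sitesPerDir 0)))) ν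
          ∨ y ν = (iterBlockOf (K - n) (fun κ => z κ - (((((F.P K).L ^ (K - n) - 1) / 2 : ℕ)) : ZMod ((F.P K).sitesPerDir 0)))) ν + 1
          ∨ y ν = (iterBlockOf (K - n) (fun κ => z κ - (((((F.P K).L ^ (K - n) - 1) / 2 : ℕ)) : ZMod ((F.P K).sitesPerDir 0)))) ν + 2))
        then ‖R (holT T (iterBlockOf (K - n) (fun κ => z κ - (((((F.P K).L ^ (K - n) - 1) / 2 : ℕ)) : ZMod ((F.P K).sitesPerDir 0)))) (treeWord (rel (iterBlockOf (K - n) (fun κ => z κ - (((((F.P K).L ^ (K - n) - 1) / 2 : ℕ)) : ZMod ((F.P K).sitesPerDir 0)))) y))) (ψ (embIter (K - n) y)) - ψ (embIter (K - n) (iterBlockOf (K - n) (fun κ => z κ - (((((F.P K).L ^ (K - n) - 1) / 2 : ℕ)) : ZMod ((F.P K).sitesPerDir 0)))))‖ ^ 2 else 0)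
      ≤ ((4 ^ (F.P K).d * (2 * (F.P K).d) ^ 2 * ((F.P K).L ^ (F.P K).d) ^ (K - n) : ℕ) : ℝ)
        * ∑ c : PBond (F.P K) (K - n), ‖covD (torusT (F.P K) (K - n)) (fun κ z => T ⟨z, κ⟩) c.dir (fun Y => ψ (embIter (K - n) Y)) c.src‖ ^ 2 :=
    sum_junction_delta_le F K n hk T hT (fun Y => ψ (embIter (K - n) Y)) (fun y z => rel (iterBlockOf (K - n) (fun κ => z κ - (((((F.P K).L ^ (K - n) - 1) / 2 : ℕ)) : ZMod ((F.P K).sitesPerDir 0)))) y) hv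
  -- (Kg″-bridge): `Σ_c δ^T_c ≤ 2(δV + Σ_c J″_c)` at ★p1's averaged field
  have h4 : ∑ c : PBond (F.P K) (K - n), ‖covD (torusT (F.P K) (K - n)) (fun κ z => T ⟨z, κ⟩) c.dir (fun Y => ψ (embIter (K - n) Y)) c.src‖ ^ 2
      ≤ 2 * ((∑ c : PBond (F.P K) (K - n), ∑ a : Fin 2, ∑ b : Fin 2,
                Complex.normSq ((ψ (embIter (K - n) c.src) - (((Averaging.iter (fun i => blockAvg (P := F.P K) (j := i) (expMeanLogSU (n := Fin 2))) (K - n) W) c : Matrix.specialUnitaryGroup (Fin 2) ℂ) : Matrix (Fin 2) (Fin 2) ℂ)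
                    * ψ (embIter (K - n) c.tgt) * star (((Averaging.iter (fun i => blockAvg (P := F.P K) (j := i) (expMeanLogSU (n := Fin 2))) (K - n) W) c : Matrix.specialUnitaryGroup (Fin 2) ℂ) : Matrix (Fin 2) (Fin 2) ℂ)) a b))
        + (∑ c : PBond (F.P K) (K - n), ‖(((unitsField (toUField (Averaging.iter (fun i => blockAvg (P := F.P K) (j := i) (expMeanLogSU (n := Fin 2))) (K - n) W)) c)⁻¹ * T c : (Matrix (Fin 2) (Fin 2) ℂ)ˣ) : Matrix (Fin 2) (Fin 2) ℂ) * ψ (embIter (K - n) c.tgt) - ψ (embIter (K - n) c.tgt) * (((unitsField (toUField (Averaging.iter (fun i => blockAvg (P := F.P K) (j := i) (expMeanLogSU (n := Fin 2))) (K - n) W)) c)⁻¹ * T c : (Matrix (Fin 2) (Fin 2) ℂ)ˣ) : Matrix (Fin 2) (Fin 2) ℂ)‖ ^ 2)) :=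
    sum_covD_sq_le_bridge (Averaging.iter (fun i => blockAvg (P := F.P K) (j := i) (expMeanLogSU (n := Fin 2))) (K - n) W) T hT (fun Y => ψ (embIter (K - n) Y))
  -- the split of the averaged junction summand
  have e : ∑ y : Site (F.P K) (K - n), ∑ z : Site (F.P K) 0,
      (if (∀ ν : Fin (F.P K).d,
          (y ν = (iterBlockOf (K - n) (fun κ => z κ - (((((F.P K).L ^ (K - n) - 1) / 2 : ℕ)) : ZMod ((F.P K).sitesPerDir 0)))) ν - 1
          ∨ y ν = (iterBlockOf (K - n) (fun κ => z κ - (((((F.P K).L ^ (K - n) - 1) / 2 : ℕ)) : ZMod ((F.P K).sitesPerDir 0)))) ν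
          ∨ y ν = (iterBlockOf (K - n) (fun κ => z κ - (((((F.P K).L ^ (K - n) - 1) / 2 : ℕ)) : ZMod ((F.P K).sitesPerDir 0)))) ν + 1
          ∨ y ν = (iterBlockOf (K - n) (fun κ => z κ - (((((F.P K).L ^ (K - n) - 1) / 2 : ℕ)) : ZMod ((F.P K).sitesPerDir 0)))) ν + 2))
        then (ℓ' : ℝ)⁻¹ * ∑ η : Fin ℓ', 2 * (‖R (holT T (iterBlockOf (K - n) (fun κ => z κ - (((((F.P K).L ^ (K - n) - 1) / 2 : ℕ)) : ZMod ((F.P K).sitesPerDir 0)))) (treeWord (rel (iterBlockOf (K - n) (fun κ => z κ - (((((F.P K).L ^ (K - n) - 1) / 2 : ℕ)) : ZMod ((F.P K).sitesPerDir 0)))) y))) (ψ (embIter (K - n) y)) - ψ (embIter (K - n) (iterBlockOf (K - n) (fun κ => z κ - (((((F.P K).L ^ (K - n) - 1) / 2 : ℕ)) : ZMod ((F.P K).sitesPerDir 0)))))‖ ^ 2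
            + ‖(((holT T (iterBlockOf (K - n) (fun κ => z κ - (((((F.P K).L ^ (K - n) - 1) / 2 : ℕ)) : ZMod ((F.P K).sitesPerDir 0)))) (treeWord (rel (iterBlockOf (K - n) (fun κ => z κ - (((((F.P K).L ^ (K - n) - 1) / 2 : ℕ)) : ZMod ((F.P K).sitesPerDir 0)))) y)))⁻¹ * holT (unitsField (toUField W)) (embIter (K - n) (iterBlockOf (K - n) (fun κ => z κ - (((((F.P K).L ^ (K - n) - 1) / 2 : ℕ)) : ZMod ((F.P K).sitesPerDir 0))))) (seg ι ((η : ℕ) : ℤ) ++ treeWord (rel (transl (embIter (K - n) (iterBlockOf (K - n) (fun κ => z κ - (((((F.P K).L ^ (K - n) - 1) / 2 : ℕ)) : ZMod ((F.P K).sitesPerDir 0))))) (((η : ℕ) : ℤ) • e ι)) z)) * (holT (unitsField (toUField W)) (embIter (K - n) y) (seg ι ((η : ℕ) : ℤ) ++ treeWord (rel (transl (embIter (K - n) y) (((η : ℕ) : ℤ) • e ι)) z)))⁻¹ : (Matrix (Fin 2) (Fin 2) ℂ)ˣ) : Matrix (Fin 2) (Fin 2) ℂ) * ψ (embIter (K -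 n) y)
                - ψ (embIter (K - n) y) * (((holT T (iterBlockOf (K - n) (fun κ => z κ - (((((F.P K).L ^ (K - n) - 1) / 2 : ℕ)) : ZMod ((F.P K).sitesPerDir 0)))) (treeWord (rel (iterBlockOf (K - n) (fun κ => z κ - (((((F.P K).L ^ (K - n) - 1) / 2 : ℕ)) : ZMod ((F.P K).sitesPerDir 0)))) y)))⁻¹ * holT (unitsField (toUField W)) (embIter (K - n) (iterBlockOf (K - n) (fun κ => z κ - (((((F.P K).L ^ (K - n) - 1) / 2 : ℕ)) : ZMod ((F.P K).sitesPerDir 0))))) (seg ι ((η : ℕ) : ℤ) ++ treeWord (rel (transl (embIter (K - n) (iterBlockOf (K - n) (fun κ => z κ - (((((F.P K).L ^ (K - n) - 1) / 2 : ℕ)) : ZMod ((F.P K).sitesPerDir 0))))) (((η : ℕ) : ℤ) • e ι)) z)) * (holT (unitsField (toUField W)) (embIter (K - n) y) (seg ι ((η : ℕ) : ℤ) ++ treeWord (rel (transl (embIter (K - n) y) (((η : ℕ) : ℤ) • e ι)) z)))⁻¹ : (Matrix (Fin 2) (Fin 2) ℂ)ˣ) : Matrix (Fin 2) (Fin 2)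 ℂ)‖ ^ 2) else 0)
      = 2 * (∑ y : Site (F.P K) (K - n), ∑ z : Site (F.P K) 0,
      (if (∀ ν : Fin (F.P K).d,
          (y ν = (iterBlockOf (K - n) (fun κ => z κ - (((((F.P K).L ^ (K - n) - 1) / 2 : ℕ)) : ZMod ((F.P K).sitesPerDir 0)))) ν - 1
          ∨ y ν = (iterBlockOf (K - n) (fun κ => z κ - (((((F.P K).L ^ (K - n) - 1) / 2 : ℕ)) : ZMod ((F.P K).sitesPerDir 0)))) ν
          ∨ y ν = (iterBlockOf (K - n) (fun κ => z κ - (((((F.P K).L ^ (K - n) - 1) / 2 : ℕ)) : ZMod ((F.P K).sitesPerDir 0)))) ν + 1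
          ∨ y ν = (iterBlockOf (K - n) (fun κ => z κ - (((((F.P K).L ^ (K - n) - 1) / 2 : ℕ)) : ZMod ((F.P K).sitesPerDir 0)))) ν + 2))
        then ‖R (holT T (iterBlockOf (K - n) (fun κ => z κ - (((((F.P K).L ^ (K - n) - 1) / 2 : ℕ)) : ZMod ((F.P K).sitesPerDir 0)))) (treeWord (rel (iterBlockOf (K - n) (fun κ => z κ - (((((F.P K).L ^ (K - n) - 1) / 2 : ℕ)) : ZMod ((F.P K).sitesPerDir 0)))) y))) (ψ (embIter (K - n) y)) - ψ (embIter (K - n) (iterBlockOf (K - n) (fun κ => z κ - (((((F.P K).L ^ (K - n) - 1) / 2 : ℕ)) : ZMod ((F.P K).sitesPerDir 0)))))‖ ^ 2 else 0))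
        + ∑ y : Site (F.P K) (K - n), ∑ z : Site (F.P K) 0,
      (if (∀ ν : Fin (F.P K).d,
          (y ν = (iterBlockOf (K - n) (fun κ => z κ - (((((F.P K).L ^ (K - n) - 1) / 2 : ℕ)) : ZMod ((F.P K).sitesPerDir 0)))) ν - 1
          ∨ y ν = (iterBlockOf (K - n) (fun κ => z κ - (((((F.P K).L ^ (K - n) - 1) / 2 : ℕ)) : ZMod ((F.P K).sitesPerDir 0)))) ν
          ∨ y ν = (iterBlockOf (K - n) (fun κ => z κ - (((((F.P K).L ^ (K - n) - 1) / 2 : ℕ)) : ZMod ((F.P K).sitesPerDir 0)))) ν + 1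
          ∨ y ν = (iterBlockOf (K - n) (fun κ => z κ - (((((F.P K).L ^ (K - n) - 1) / 2 : ℕ)) : ZMod ((F.P K).sitesPerDir 0)))) ν + 2))
        then (ℓ' : ℝ)⁻¹ * ∑ η : Fin ℓ', 2 * ‖(((holT T (iterBlockOf (K - n) (fun κ => z κ - (((((F.P K).L ^ (K - n) - 1) / 2 : ℕ)) : ZMod ((F.P K).sitesPerDir 0)))) (treeWord (rel (iterBlockOf (K - n) (fun κ => z κ - (((((F.P K).L ^ (K - n) - 1) / 2 : ℕ)) : ZMod ((F.P K).sitesPerDir 0)))) y)))⁻¹ * holT (unitsField (toUField W)) (embIter (K - n) (iterBlockOf (K - n) (fun κ => z κ - (((((F.P K).L ^ (K - n) - 1) / 2 : ℕ)) : ZMod ((F.P K).sitesPerDir 0))))) (seg ι ((η : ℕ) : ℤ) ++ treeWord (rel (transl (embIter (K - n) (iterBlockOf (K - n) (fun κ => z κ - (((((F.P K).L ^ (K - n) - 1) / 2 : ℕ)) : ZMod ((F.P K).sitesPerDir 0))))) (((η : ℕ) : ℤ) • e ι)) z)) * (holT (unitsField (toUField W)) (embIter (K - n) y) (seg ι ((η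 : ℕ) : ℤ) ++ treeWord (rel (transl (embIter (K - n) y) (((η : ℕ) : ℤ) • e ι)) z)))⁻¹ : (Matrix (Fin 2) (Fin 2) ℂ)ˣ) : Matrix (Fin 2) (Fin 2) ℂ) * ψ (embIter (K - n) y)
                - ψ (embIter (K - n) y) * (((holT T (iterBlockOf (K - n) (fun κ => z κ - (((((F.P K).L ^ (K - n) - 1) / 2 : ℕ)) : ZMod ((F.P K).sitesPerDir 0)))) (treeWord (rel (iterBlockOf (K - n) (fun κ => z κ - (((((F.P K).L ^ (K - n) - 1) / 2 : ℕ)) : ZMod ((F.P K).sitesPerDir 0)))) y)))⁻¹ * holT (unitsField (toUField W)) (embIter (K - n) (iterBlockOf (K - n) (fun κ => z κ - (((((F.P K).L ^ (K - n) - 1) / 2 : ℕ)) : ZMod ((F.P K).sitesPerDir 0))))) (seg ι ((η : ℕ) : ℤ) ++ treeWord (rel (transl (embIter (K - n) (iterBlockOf (K - n) (fun κ => z κ - (((((F.P K).L ^ (K - n) - 1) / 2 : ℕ)) : ZMod ((F.P K).sitesPerDir 0))))) (((η : ℕ) : ℤ) • e ι)) z)) * (holT (unitsField (toUField W)) (embIter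 (K - n) y) (seg ι ((η : ℕ) : ℤ) ++ treeWord (rel (transl (embIter (K - n) y) (((η : ℕ) : ℤ) • e ι)) z)))⁻¹ : (Matrix (Fin 2) (Fin 2) ℂ)ˣ) : Matrix (Fin 2) (Fin 2) ℂ)‖ ^ 2 else 0) :=
    sum_sum_ite_avg_split
      (fun (y : Site (F.P K) (K - n)) (z : Site (F.P K) 0) => (∀ ν : Fin (F.P K).d,
          (y ν = (iterBlockOf (K - n) (fun κ => z κ - (((((F.P K).L ^ (K - n) - 1) / 2 : ℕ)) : ZMod ((F.P K).sitesPerDir 0)))) ν - 1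
          ∨ y ν = (iterBlockOf (K - n) (fun κ => z κ - (((((F.P K).L ^ (K - n) - 1) / 2 : ℕ)) : ZMod ((F.P K).sitesPerDir 0)))) ν
          ∨ y ν = (iterBlockOf (K - n) (fun κ => z κ - (((((F.P K).L ^ (K - n) - 1) / 2 : ℕ)) : ZMod ((F.P K).sitesPerDir 0)))) ν + 1
          ∨ y ν = (iterBlockOf (K - n) (fun κ => z κ - (((((F.P K).L ^ (K - n) - 1) / 2 : ℕ)) : ZMod ((F.P K).sitesPerDir 0)))) ν + 2))) ℓ'
      (fun y z => ‖R (holT T (iterBlockOf (K - n) (fun κ => z κ - (((((F.P K).L ^ (K - n) - 1) / 2 : ℕ)) : ZMod ((F.P K).sitesPerDir 0)))) (treeWord (rel (iterBlockOf (K - n) (fun κ => z κ - (((((F.P K).L ^ (K - n) - 1) / 2 : ℕ)) : ZMod ((F.P K).sitesPerDir 0)))) y))) (ψ (embIter (K - n) y)) - ψ (embIter (K - n) (iterBlockOf (K - n) (fun κ => z κ - (((((F.P K).L ^ (K - n) - 1) / 2 : ℕ)) : ZMod ((F.P K).sitesPerDir 0)))))‖ ^ 2)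
      (fun y z η => ‖(((holT T (iterBlockOf (K - n) (fun κ => z κ - (((((F.P K).L ^ (K - n) - 1) / 2 : ℕ)) : ZMod ((F.P K).sitesPerDir 0)))) (treeWord (rel (iterBlockOf (K - n) (fun κ => z κ - (((((F.P K).L ^ (K - n) - 1) / 2 : ℕ)) : ZMod ((F.P K).sitesPerDir 0)))) y)))⁻¹ * holT (unitsField (toUField W)) (embIter (K - n) (iterBlockOf (K - n) (fun κ => z κ - (((((F.P K).L ^ (K - n) - 1) / 2 : ℕ)) : ZMod ((F.P K).sitesPerDir 0))))) (seg ι ((η : ℕ) : ℤ) ++ treeWord (rel (transl (embIter (K - n) (iterBlockOf (K - n) (fun κ => z κ - (((((F.P K).L ^ (K - n) - 1) / 2 : ℕ)) : ZMod ((F.P K).sitesPerDir 0))))) (((η : ℕ) : ℤ) • e ι)) z)) * (holT (unitsField (toUField W)) (embIter (K - n) y) (seg ι ((η : ℕ) : ℤ) ++ treeWord (rel (transl (embIter (K - n) y) (((η : ℕ) : ℤ) • e ι)) z)))⁻¹ : (Matrix (Fin 2) (Fin 2) ℂ)ˣ) : Matrix (Fin 2) (Fin 2) ℂ) * ψ (embIter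 (K - n) y)
                - ψ (embIter (K - n) y) * (((holT T (iterBlockOf (K - n) (fun κ => z κ - (((((F.P K).L ^ (K - n) - 1) / 2 : ℕ)) : ZMod ((F.P K).sitesPerDir 0)))) (treeWord (rel (iterBlockOf (K - n) (fun κ => z κ - (((((F.P K).L ^ (K - n) - 1) / 2 : ℕ)) : ZMod ((F.P K).sitesPerDir 0)))) y)))⁻¹ * holT (unitsField (toUField W)) (embIter (K - n) (iterBlockOf (K - n) (fun κ => z κ - (((((F.P K).L ^ (K - n) - 1) / 2 : ℕ)) : ZMod ((F.P K).sitesPerDir 0))))) (seg ι ((η : ℕ) : ℤ) ++ treeWord (rel (transl (embIter (K - n) (iterBlockOf (K - n) (fun κ => z κ - (((((F.P K).L ^ (K - n) - 1) / 2 : ℕ)) : ZMod ((F.P K).sitesPerDir 0))))) (((η : ℕ) : ℤ) • e ι)) z)) * (holT (unitsField (toUField W)) (embIter (K - n) y) (seg ι ((η : ℕ) : ℤ) ++ treeWord (rel (transl (embIter (K - n) y) (((η : ℕ) : ℤ) • e ι)) z)))⁻¹ : (Matrix (Fin 2) (Fin 2) ℂ)ˣ) : Matrix (Fin 2) (Fin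 2) ℂ)‖ ^ 2)
  have e2 := congrArg (fun t : ℝ => 2 * (3 * (((F.P K).d : ℝ) * (24 / ((((F.P K).L ^ (K - n) : ℕ) : ℝ)) ^ 2) ^ 2)) * (((F.P K).d : ℝ) * t)) e
  -- the constant: `c_G·d·2·(4^d(2d)²ℓ^d)·2 = 286654464·ℓ⁻¹` at `d = 3`
  have hL1 : (1 : ℝ) < F.L := by exact_mod_cast F.hL.2
  have hℓ : ((F.L : ℝ) ^ (K - n)) ≠ 0 := by positivity
  have hC : ∀ X : ℝ, 2 * (3 * (((F.P K).d : ℝ) * (24 / ((((F.P K).L ^ (K - n) : ℕ) : ℝ)) ^ 2) ^ 2)) * (((F.P K).d : ℝ) * (2 * (((4 ^ (F.P K).d * (2 * (F.P K).d) ^ 2 * ((F.P K).L ^ (F.P K).d) ^ (K - n) : ℕ) : ℝ) * (2 * X))))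
      = 286654464 * ((F.L : ℝ) ^ (K - n))⁻¹ * X := by
    intro X
    have hd : (F.P K).d = 3 := T3Family.P_d F K
    have hL : (F.P K).L = F.L := rfl
    obtain ⟨ℓ, hℓdef⟩ : ∃ ℓ : ℝ, (F.L : ℝ) ^ (K - n) = ℓ := ⟨_, rfl⟩
    have hℓ0 : ℓ ≠ 0 := by rw [← hℓdef]; exact hℓ
    have c1 : ((((F.P K).L ^ (K - n) : ℕ) : ℝ)) = ℓ := by rw [hL]; push_cast; exact hℓdef
    have c2 : ((4 ^ (F.P K).d * (2 * (F.P K).d) ^ 2 * ((F.P K).L ^ (F.P K).d) ^ (K - n) : ℕ) : ℝ) = 2304 * ℓ ^ 3 := by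
      rw [hd, hL]; push_cast; rw [← hℓdef]; ring
    have c3 : ((F.P K).d : ℝ) = 3 := by rw [hd]; norm_num
    rw [c1, c2, c3, hℓdef]
    field_simp
    ring
  have hcG : (0 : ℝ) ≤ 2 * (3 * (((F.P K).d : ℝ) * (24 / ((((F.P K).L ^ (K - n) : ℕ) : ℝ)) ^ 2) ^ 2)) := by positivity
  have hd0 : (0 : ℝ) ≤ ((F.P K).d : ℝ) := by positivity
  have hCnt : (0 : ℝ) ≤ ((4 ^ (F.P K).d * (2 * (F.P K).d) ^ 2 * ((F.P K).L ^ (F.P K).d) ^ (K - n) : ℕ) : ℝ) := by positivity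
  have h34 := h3.trans (mul_le_mul_of_nonneg_left h4 hCnt)
  have h5 := mul_le_mul_of_nonneg_left (mul_le_mul_of_nonneg_left (mul_le_mul_of_nonneg_left h34 (zero_le_two : (0 : ℝ) ≤ 2)) hd0) hcG
  rw [hC] at h5
  linarith [e2, h5, hKgJ, hKg2]

/-- ★★ **hJunc OF THE δ-ROWS AT THE STRAIGHT SEGMENT TRANSPORTS** — ✓ `hJunc_of_deltaRows` with the coarse field `T c := 𝒲(c_(c₋); [c.dir]^ℓ)` (`ℓ = L^(K−n)` forward letters from the
centre of the source block: the straight coarse transport `c_(c₋) → c_(c₊)`), whose bi-contractivity is ✓ `bicontr_holT`; rows (Kg″), (Kg′-J) DISPLAYED at this `T`.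
[cite: Balaban1985BackgroundPropagators, (3.1) p.390, (3.3) p.390, (3.12) p.392] [cite: Balaban1985Averaging, (9) p.18, (19)-(20) p.21] [cite: Balaban1985UV3, (27) p.263] -/
theorem hJunc_of_deltaRows_straight (F : T3Family) (K n : ℕ) (hk : K - n ≤ (F.P K).m + (F.P K).K)
    (W : GaugeField (F.P K) 0 (Matrix.specialUnitaryGroup (Fin 2) ℂ)) (ψ : Site (F.P K) 0 → Matrix (Fin 2) (Fin 2) ℂ)
    (ι : Fin (F.P K).d) (ℓ' : ℕ) [NeZero ℓ']
    {Kr Mr ee ζ₁ θ₁ ζ₂ θ₂ : ℝ}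
    (hKg2 : 286654464 * ((F.L : ℝ) ^ (K - n))⁻¹ * (∑ c : PBond (F.P K) (K - n), ‖(((unitsField (toUField (Averaging.iter (fun i => blockAvg (P := F.P K) (j := i) (expMeanLogSU (n := Fin 2))) (K - n) W)) c)⁻¹ * holT (unitsField (toUField W)) (embIter (K - n) c.src) (seg c.dir (((F.P K).L ^ (K - n) : ℕ) : ℤ)) : (Matrix (Fin 2) (Fin 2) ℂ)ˣ) : Matrix (Fin 2) (Fin 2) ℂ) * ψ (embIter (K - n) c.tgt) - ψ (embIter (K - n) c.tgt) * (((unitsField (toUField (Averaging.iter (fun i => blockAvg (P := F.P K) (j := i) (expMeanLogSU (n := Fin 2))) (K - n) W)) c)⁻¹ * holT (unitsField (toUField W)) (embIter (K - n) c.src) (seg c.dir (((F.P K).L ^ (K - n) : ℕ) : ℤ)) : (Matrix (Fin 2) (Fin 2) ℂ)ˣ) : Matrix (Fin 2) (Fin 2) ℂ)‖ ^ 2)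
        ≤ ζ₁ * Kr + θ₁ * ee * (((F.L : ℝ) ^ (K - n)) ^ 2)⁻¹ * Mr)
    (hKgJ : 2 * (3 * (((F.P K).d : ℝ) * (24 / ((((F.P K).L ^ (K - n) : ℕ) : ℝ)) ^ 2) ^ 2))
          * (((F.P K).d : ℝ) * ∑ y : Site (F.P K) (K - n), ∑ z : Site (F.P K) 0,
      (if (∀ ν : Fin (F.P K).d,
          (y ν = (iterBlockOf (K - n) (fun κ => z κ - (((((F.P K).L ^ (K - n) - 1) / 2 : ℕ)) : ZMod ((F.P K).sitesPerDir 0)))) ν - 1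
          ∨ y ν = (iterBlockOf (K - n) (fun κ => z κ - (((((F.P K).L ^ (K - n) - 1) / 2 : ℕ)) : ZMod ((F.P K).sitesPerDir 0)))) ν
          ∨ y ν = (iterBlockOf (K - n) (fun κ => z κ - (((((F.P K).L ^ (K - n) - 1) / 2 : ℕ)) : ZMod ((F.P K).sitesPerDir 0)))) ν + 1
          ∨ y ν = (iterBlockOf (K - n) (fun κ => z κ - (((((F.P K).L ^ (K - n) - 1) / 2 : ℕ)) : ZMod ((F.P K).sitesPerDir 0)))) ν + 2))
        then (ℓ' : ℝ)⁻¹ * ∑ η : Fin ℓ', 2 * ‖(((holT (fun c : PBond (F.P K) (K - n) => holT (unitsField (toUField W)) (embIter (K - n) c.src) (seg c.dir (((F.P K).L ^ (K - n) : ℕ) : ℤ))) (iterBlockOf (K - n) (fun κ => z κ - (((((F.P K).L ^ (K - n) - 1) / 2 : ℕ)) : ZMod ((F.P K).sitesPerDir 0)))) (treeWord (rel (iterBlockOf (K - n) (fun κ => z κ - (((((F.P K).L ^ (K - n) - 1) / 2 : ℕ)) : ZMod ((F.P K).sitesPerDir 0)))) y)))⁻¹ * holT (unitsField (toUField W)) (embIter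 (K - n) (iterBlockOf (K - n) (fun κ => z κ - (((((F.P K).L ^ (K - n) - 1) / 2 : ℕ)) : ZMod ((F.P K).sitesPerDir 0))))) (seg ι ((η : ℕ) : ℤ) ++ treeWord (rel (transl (embIter (K - n) (iterBlockOf (K - n) (fun κ => z κ - (((((F.P K).L ^ (K - n) - 1) / 2 : ℕ)) : ZMod ((F.P K).sitesPerDir 0))))) (((η : ℕ) : ℤ) • e ι)) z)) * (holT (unitsField (toUField W)) (embIter (K - n) y) (seg ι ((η : ℕ) : ℤ) ++ treeWord (rel (transl (embIter (K - n) y) (((η : ℕ) : ℤ) • e ι)) z)))⁻¹ : (Matrix (Fin 2) (Fin 2) ℂ)ˣ) : Matrix (Fin 2) (Fin 2) ℂ) * ψ (embIter (K - n) y)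
                - ψ (embIter (K - n) y) * (((holT (fun c : PBond (F.P K) (K - n) => holT (unitsField (toUField W)) (embIter (K - n) c.src) (seg c.dir (((F.P K).L ^ (K - n) : ℕ) : ℤ))) (iterBlockOf (K - n) (fun κ => z κ - (((((F.P K).L ^ (K - n) - 1) / 2 : ℕ)) : ZMod ((F.P K).sitesPerDir 0)))) (treeWord (rel (iterBlockOf (K - n) (fun κ => z κ - (((((F.P K).L ^ (K - n) - 1) / 2 : ℕ)) : ZMod ((F.P K).sitesPerDir 0)))) y)))⁻¹ * holT (unitsField (toUField W)) (embIter (K - n) (iterBlockOf (K - n) (fun κ => z κ - (((((F.P K).L ^ (K - n) - 1) / 2 : ℕ)) : ZMod ((F.P K).sitesPerDir 0))))) (seg ι ((η : ℕ) : ℤ) ++ treeWord (rel (transl (embIter (K - n) (iterBlockOf (K - n) (fun κ => z κ - (((((F.P K).L ^ (K - n) - 1) / 2 : ℕ)) : ZMod ((F.P K).sitesPerDir 0))))) (((η : ℕ) : ℤ) • e ι)) z)) * (holT (unitsField (toUField W)) (embIter (K - n) y) (seg ι ((η : ℕ) : ℤ) ++ treeWord (rel (transl (embIter (K - n) y) (((η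 : ℕ) : ℤ) • e ι)) z)))⁻¹ : (Matrix (Fin 2) (Fin 2) ℂ)ˣ) : Matrix (Fin 2) (Fin 2) ℂ)‖ ^ 2 else 0))
        ≤ ζ₂ * Kr + θ₂ * ee * (((F.L : ℝ) ^ (K - n)) ^ 2)⁻¹ * Mr) :
    2 * (3 * (((F.P K).d : ℝ) * (24 / ((((F.P K).L ^ (K - n) : ℕ) : ℝ)) ^ 2) ^ 2))
          * (((F.P K).d : ℝ) * ∑ y : Site (F.P K) (K - n), ∑ z : Site (F.P K) 0,
      (if (∀ ν : Fin (F.P K).d,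
          (y ν = (iterBlockOf (K - n) (fun κ => z κ - (((((F.P K).L ^ (K - n) - 1) / 2 : ℕ)) : ZMod ((F.P K).sitesPerDir 0)))) ν - 1
          ∨ y ν = (iterBlockOf (K - n) (fun κ => z κ - (((((F.P K).L ^ (K - n) - 1) / 2 : ℕ)) : ZMod ((F.P K).sitesPerDir 0)))) ν
          ∨ y ν = (iterBlockOf (K - n) (fun κ => z κ - (((((F.P K).L ^ (K - n) - 1) / 2 : ℕ)) : ZMod ((F.P K).sitesPerDir 0)))) ν + 1
          ∨ y ν = (iterBlockOf (K - n) (fun κ => z κ - (((((F.P K).L ^ (K - n) - 1) / 2 : ℕ)) : ZMod ((F.P K).sitesPerDir 0)))) ν + 2))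
        then (ℓ' : ℝ)⁻¹ * ∑ η : Fin ℓ', 2 * (‖R (holT (fun c : PBond (F.P K) (K - n) => holT (unitsField (toUField W)) (embIter (K - n) c.src) (seg c.dir (((F.P K).L ^ (K - n) : ℕ) : ℤ))) (iterBlockOf (K - n) (fun κ => z κ - (((((F.P K).L ^ (K - n) - 1) / 2 : ℕ)) : ZMod ((F.P K).sitesPerDir 0)))) (treeWord (rel (iterBlockOf (K - n) (fun κ => z κ - (((((F.P K).L ^ (K - n) - 1) / 2 : ℕ)) : ZMod ((F.P K).sitesPerDir 0)))) y))) (ψ (embIter (K - n) y)) - ψ (embIter (K - n) (iterBlockOf (K - n) (fun κ => z κ - (((((F.P K).L ^ (K - n) - 1) / 2 : ℕ)) : ZMod ((F.P K).sitesPerDir 0)))))‖ ^ 2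
            + ‖(((holT (fun c : PBond (F.P K) (K - n) => holT (unitsField (toUField W)) (embIter (K - n) c.src) (seg c.dir (((F.P K).L ^ (K - n) : ℕ) : ℤ))) (iterBlockOf (K - n) (fun κ => z κ - (((((F.P K).L ^ (K - n) - 1) / 2 : ℕ)) : ZMod ((F.P K).sitesPerDir 0)))) (treeWord (rel (iterBlockOf (K - n) (fun κ => z κ - (((((F.P K).L ^ (K - n) - 1) / 2 : ℕ)) : ZMod ((F.P K).sitesPerDir 0)))) y)))⁻¹ * holT (unitsField (toUField W)) (embIter (K - n) (iterBlockOf (K - n) (fun κ => z κ - (((((F.P K).L ^ (K - n) - 1) / 2 : ℕ)) : ZMod ((F.P K).sitesPerDir 0))))) (seg ι ((η : ℕ) : ℤ) ++ treeWord (rel (transl (embIter (K - n) (iterBlockOf (K - n) (fun κ => z κ - (((((F.P K).L ^ (K - n) - 1) / 2 : ℕ)) : ZMod ((F.P K).sitesPerDir 0))))) (((η : ℕ) : ℤ) • e ι)) z)) * (holT (unitsField (toUField W)) (embIter (K - n) y) (seg ι ((η : ℕ) : ℤ) ++ treeWord (rel (transl (embIter (K - n) y) (((η : ℕ) : ℤ)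 • e ι)) z)))⁻¹ : (Matrix (Fin 2) (Fin 2) ℂ)ˣ) : Matrix (Fin 2) (Fin 2) ℂ) * ψ (embIter (K - n) y)
                - ψ (embIter (K - n) y) * (((holT (fun c : PBond (F.P K) (K - n) => holT (unitsField (toUField W)) (embIter (K - n) c.src) (seg c.dir (((F.P K).L ^ (K - n) : ℕ) : ℤ))) (iterBlockOf (K - n) (fun κ => z κ - (((((F.P K).L ^ (K - n) - 1) / 2 : ℕ)) : ZMod ((F.P K).sitesPerDir 0)))) (treeWord (rel (iterBlockOf (K - n) (fun κ => z κ - (((((F.P K).L ^ (K - n) - 1) / 2 : ℕ)) : ZMod ((F.P K).sitesPerDir 0)))) y)))⁻¹ * holT (unitsField (toUField W)) (embIter (K - n) (iterBlockOf (K - n) (fun κ => z κ - (((((F.P K).L ^ (K - n) - 1) / 2 : ℕ)) : ZMod ((F.P K).sitesPerDir 0))))) (seg ι ((η : ℕ) : ℤ) ++ treeWord (rel (transl (embIter (K - n) (iterBlockOf (K - n) (fun κ => z κ - (((((F.P K).L ^ (K - n) - 1) / 2 : ℕ)) : ZMod ((F.P K).sitesPerDir 0))))) (((η : ℕ) : ℤ)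 • e ι)) z)) * (holT (unitsField (toUField W)) (embIter (K - n) y) (seg ι ((η : ℕ) : ℤ) ++ treeWord (rel (transl (embIter (K - n) y) (((η : ℕ) : ℤ) • e ι)) z)))⁻¹ : (Matrix (Fin 2) (Fin 2) ℂ)ˣ) : Matrix (Fin 2) (Fin 2) ℂ)‖ ^ 2) else 0))
        ≤ 286654464 * ((F.L : ℝ) ^ (K - n))⁻¹ * (∑ c : PBond (F.P K) (K - n), ∑ a : Fin 2, ∑ b : Fin 2,
                Complex.normSq ((ψ (embIter (K - n) c.src) - (((Averaging.iter (fun i => blockAvg (P := F.P K) (j := i) (expMeanLogSU (n := Fin 2))) (K - n) W) c : Matrix.specialUnitaryGroup (Fin 2) ℂ) : Matrix (Fin 2) (Fin 2) ℂ)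
                    * ψ (embIter (K - n) c.tgt) * star (((Averaging.iter (fun i => blockAvg (P := F.P K) (j := i) (expMeanLogSU (n := Fin 2))) (K - n) W) c : Matrix.specialUnitaryGroup (Fin 2) ℂ) : Matrix (Fin 2) (Fin 2) ℂ)) a b)) + (ζ₁ + ζ₂) * Kr + (θ₁ + θ₂) * ee * (((F.L : ℝ) ^ (K - n)) ^ 2)⁻¹ * Mr := by
  have hV : ∀ b : PBond (F.P K) 0, ‖((unitsField (toUField W) b : (Matrix (Fin 2) (Fin 2) ℂ)ˣ) : Matrix (Fin 2) (Fin 2) ℂ)‖ ≤ 1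
      ∧ ‖(((unitsField (toUField W) b)⁻¹ : (Matrix (Fin 2) (Fin 2) ℂ)ˣ) : Matrix (Fin 2) (Fin 2) ℂ)‖ ≤ 1 :=
    fun b => bicontr_of_mem_unitary _ (unitsField_toUField_mem_unitary W b.dir b.src)
  exact hJunc_of_deltaRows F K n hk W ψ ι ℓ'
    (fun c : PBond (F.P K) (K - n) => holT (unitsField (toUField W)) (embIter (K - n) c.src) (seg c.dir (((F.P K).L ^ (K - n) : ℕ) : ℤ)))
    (fun c => bicontr_holT (unitsField (toUField W)) hV _ _) hKg2 hKgJ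

end T3

end Summit.QuantumFields.YangMills.Theorems.Prop7HJuncOfDeltaRows

end
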